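import Mathlib
import Summits.NavierStokesRegularity.NavierStokesRegularity.Theorems.TaoLadderRungTwoFlatGappedFrontRobustTailEnergyOn
import HarnessLib

/-!
# Shift-set pseudo-flows `PseudoFlowOnShift 𝕊`: the ONE-DIRECTIONAL TAIL STEP with backscatter
  (Bihari–Grönwall form of the tail energy cap; helper for item stmt-NavierStokesRegularity-22988
  `GappedFrontRobustV2Flat`, crux K_B♭ of route TaoLadderRungTwoFlat)

The `𝕊`-parametrised version of `Theorems/TaoLadderRungThreeGappedFrontRobustTailStep.lean` (p1 g9, one-way
`S`). By `pseudoFlowOnShift_tail_energy_le` the energy `y = ∑ᵢ F_{i,K}` of the shell `K` (indeed of every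
block above the bond `K-1 | K`) is at most `E₀ + ∫ B_𝕊(K-1)`, and by `abs_botSumOn_le_tail`
`|B_𝕊(K-1)| ≤ Λ C (P² √(2y) + 2 P y)` when `|S_{i,K-1}| ≤ P` (`Λ = (1+ε₀)^{5(K-1)/2}`,
`C = ∑_{botShifts 𝕊}|α|`): an integral inequality `y ≤ E₀ + ∫ (a √y + b y)` with CONSTANT
`a = √2 Λ C P²` (the one-way pumping, as on `S`) and `b = 2 Λ C P` (the backscatter classes, linear in
the energy above the bond). The Bihari–Grönwall lemma `sqrt_le_of_integral_le_sqrt_add_linear`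
(`√y(s) ≤ (√E₀ + a s/2) e^{b s/2}`) turns it into
`|S_{i,K}(s)| ≤ √2 (√E₀ + (√2/2) Λ C P² s) · exp(Λ C P s)`
(`pseudoFlowOnShift_sqrt_shell_energy_le_tail`, `pseudoFlowOnShift_abs_le_tail_step`) — the `S` tail
step times `exp(Λ_{K-1} C P τ)`, a factor `≤ 2` far ahead of the front where
`Λ_{K-1} P ≍ (1+ε₀)^{5(K-1)/2} r / w(K-2) → 0`. Iterating (`pseudoFlowOnShift_tail_induction`) controls
every tail shell from the one below it: no bootstrap over the infinitely many tail shells.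

HONEST FRAMING: elementary real-analysis lemmas about Tao-type MODEL lattice pseudo-flows (Tao 2016 §4
(4.5), (4.9)–(4.10) with (4.3)) on a general nearest-neighbour shift set; nothing here is a statement
about the Navier–Stokes equations, and nothing is asserted about any table (p1 g12).
-/

noncomputable section

-- the sub-problem namespace `Summit.NavierStokesRegularity.NavierStokesRegularity` repeats the summit name by design (D-0017)
set_option linter.dupNamespace false

namespace Summit.NavierStokesRegularity.NavierStokesRegularity.Theorems

open Set MeasureTheory intervalIntegral Literature.Analysis.FluidPDE Literature.Analysis.FluidPDE.TaoCascade

namespace GappedFrontRobustOn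

variable {m : ℕ} {𝕊 : Finset (ℤ × ℤ × ℤ)}

/-! ### The Bihari–Grönwall square-root lemma -/

/-- **Bihari–Grönwall square-root lemma.** If `y` is continuous and nonnegative on `[0, τ]`,
`y₀, a, b ≥ 0`, and `y(s) ≤ y₀ + ∫₀^s (a √(y(u)) + b y(u)) du` on `[0, τ]`, then
`√(y(s)) ≤ (√y₀ + a s / 2) · exp(b s / 2)` on `[0, τ]`. (Compare `Y := y₀ + ε + ∫₀ (a√y + b y)`, whose
square root `f` has `f' ≤ a/2 + (b/2) f`, with the boundary function `(√(y₀+ε) + a x/2) e^{b x/2}`;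
let `ε → 0`.) [folklore] -/
theorem sqrt_le_of_integral_le_sqrt_add_linear {y : ℝ → ℝ} {τ y₀ a b : ℝ}
    (hy : ContinuousOn y (Icc 0 τ)) (hy0 : ∀ s ∈ Icc 0 τ, 0 ≤ y s) (hy₀ : 0 ≤ y₀) (ha : 0 ≤ a)
    (hb : 0 ≤ b)
    (hle : ∀ s ∈ Icc 0 τ, y s ≤ y₀ + ∫ u in (0 : ℝ)..s, (a * Real.sqrt (y u) + b * y u)) :
    ∀ s ∈ Icc 0 τ, Real.sqrt (y s) ≤ (Real.sqrt y₀ + a * s / 2) * Real.exp (b * s / 2) := by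
  intro s hs
  have hτ : 0 ≤ τ := hs.1.trans hs.2
  -- clamp to `[0, τ]` and extend the data continuously to `ℝ`
  set c : ℝ → ℝ := fun u => max 0 (min u τ) with hc
  have hc_mem : ∀ u, c u ∈ Icc 0 τ := fun u => ⟨le_max_left _ _, max_le hτ (min_le_right _ _)⟩
  have hc_id : ∀ u ∈ Icc 0 τ, c u = u := fun u hu => by
    simp only [hc, min_eq_left hu.2, max_eq_right hu.1]
  have hc_cont : Continuous c := continuous_const.max (continuous_id.min continuous_const)
  set G : ℝ → ℝ := fun u => a * Real.sqrt (y (c u)) + b * y (c u) with hG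
  have hyc_cont : Continuous fun u => y (c u) := hy.comp_continuous hc_cont hc_mem
  have hG_cont : Continuous G := (continuous_const.mul hyc_cont.sqrt).add (continuous_const.mul hyc_cont)
  have hG0 : ∀ u, 0 ≤ G u := fun u =>
    add_nonneg (mul_nonneg ha (Real.sqrt_nonneg _)) (mul_nonneg hb (hy0 _ (hc_mem u)))
  have hGint : ∀ x ∈ Icc 0 τ,
      ∫ u in (0 : ℝ)..x, G u = ∫ u in (0 : ℝ)..x, (a * Real.sqrt (y u) + b * y u) := by
    intro x hx
    refine intervalIntegral.integral_congr fun u hu => ?_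
    rw [uIcc_of_le hx.1] at hu
    simp only [hG, hc_id u ⟨hu.1, hu.2.trans hx.2⟩]
  refine le_of_forall_pos_le_add fun δ' hδ' => ?_
  set e : ℝ := Real.exp (b * s / 2) with hedef
  have hexp0 : 0 < e := Real.exp_pos _
  have hs0 : 0 ≤ s := hs.1
  set δ : ℝ := δ' / (2 * e) with hδdef
  have hδ : 0 < δ := by positivity
  set η : ℝ := δ' / (2 * (s + 1) * e) with hηdef
  have hη : 0 < η := by positivity
  set ε : ℝ := δ ^ 2 with hε
  have hεpos : 0 < ε := by positivity
  -- the comparison function `Y` and its square root `f`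
  set Y : ℝ → ℝ := fun x => y₀ + ε + ∫ u in (0 : ℝ)..x, G u with hY
  have hYderiv : ∀ x, HasDerivAt Y (G x) x := fun x =>
    (intervalIntegral.integral_hasDerivAt_right (hG_cont.intervalIntegrable 0 x)
      (hG_cont.stronglyMeasurableAtFilter _ _) hG_cont.continuousAt).const_add (y₀ + ε)
  have hYge : ∀ x, 0 ≤ x → ε ≤ Y x := fun x hx => by
    have : 0 ≤ ∫ u in (0 : ℝ)..x, G u := intervalIntegral.integral_nonneg hx fun u _ => hG0 u
    simp only [hY]
    linarith
  set f : ℝ → ℝ := fun x => Real.sqrt (Y x) with hf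
  have hfderiv : ∀ x, 0 ≤ x → HasDerivAt f (G x / (2 * Real.sqrt (Y x))) x := fun x hx =>
    (hYderiv x).sqrt (by linarith [hYge x hx])
  -- the boundary function `B x = (√(y₀+ε) + (a/2 + η) x) e^{b x/2}` (slope raised by `η` for strictness)
  set A : ℝ → ℝ := fun x => Real.sqrt (y₀ + ε) + (a / 2 + η) * x with hA
  have hAderiv : ∀ x, HasDerivAt A (a / 2 + η) x := fun x => by
    have h1 : HasDerivAt (fun x => (a / 2 + η) * x) ((a / 2 + η) * 1) x :=
      (hasDerivAt_id x).const_mul (a / 2 + η)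
    have h2 := h1.const_add (Real.sqrt (y₀ + ε))
    rw [mul_one] at h2
    exact h2
  have hEderiv : ∀ x, HasDerivAt (fun x => Real.exp (b * x / 2)) (Real.exp (b * x / 2) * (b / 2)) x :=
    fun x => by
      have h1 : HasDerivAt (fun x => b * x / 2) (b * 1 / 2) x :=
        ((hasDerivAt_id x).const_mul b).div_const 2
      have h2 := h1.exp
      rw [mul_one] at h2
      exact h2
  set B : ℝ → ℝ := fun x => A x * Real.exp (b * x / 2) with hB
  have hBderiv : ∀ x, HasDerivAt B
      ((a / 2 + η) * Real.exp (b * x / 2) + A x * (Real.exp (b * x / 2) * (b / 2))) x :=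
    fun x => (hAderiv x).mul (hEderiv x)
  -- `y ≤ Y - ε` on `[0, τ]`
  have hyY : ∀ x ∈ Icc 0 τ, y x ≤ Y x - ε := fun x hx => by
    have := hle x hx
    simp only [hY, hGint x hx]
    linarith
  have hA0 : ∀ x, 0 ≤ x → 0 ≤ A x := fun x hx => by
    simp only [hA]; positivity
  have key : ∀ ⦃x⦄, x ∈ Icc 0 τ → f x ≤ B x := by
    refine image_le_of_deriv_right_lt_deriv_boundary' (f' := fun x => G x / (2 * Real.sqrt (Y x)))
      (B' := fun x => (a / 2 + η) * Real.exp (b * x / 2) + A x * (Real.exp (b * x / 2) * (b / 2)))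
      ?_ ?_ ?_ ?_ ?_ ?_
    · exact fun x hx => ((hfderiv x hx.1).continuousAt).continuousWithinAt
    · exact fun x hx => (hfderiv x hx.1).hasDerivWithinAt
    · simp only [hf, hB, hA, hY, intervalIntegral.integral_same, add_zero, mul_zero, zero_div,
        Real.exp_zero, mul_one, le_refl]
    · exact fun x _ => ((hBderiv x).continuousAt).continuousWithinAt
    · exact fun x _ => (hBderiv x).hasDerivWithinAt
    · intro x hx hfx
      have hxI : x ∈ Icc 0 τ := ⟨hx.1, hx.2.le⟩
      have hfpos : 0 < f x := Real.sqrt_pos.mpr (by linarith [hYge x hx.1])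
      have hsq : Real.sqrt (y (c x)) ≤ f x := by
        rw [hc_id x hxI]
        exact Real.sqrt_le_sqrt (by linarith [hyY x hxI])
      have hyf : y (c x) ≤ f x ^ 2 := by
        rw [hc_id x hxI, hf, Real.sq_sqrt (by linarith [hYge x hx.1])]
        linarith [hyY x hxI]
      -- G x ≤ a f + b f²
      have hG1 : G x ≤ a * f x + b * f x ^ 2 := by
        simp only [hG]
        exact add_le_add (mul_le_mul_of_nonneg_left hsq ha) (mul_le_mul_of_nonneg_left hyf hb)
      -- f' ≤ a/2 + (b/2) f
      have hf' : G x / (2 * Real.sqrt (Y x)) ≤ a / 2 + b / 2 * f x := by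
        have : Real.sqrt (Y x) = f x := rfl
        rw [this, div_le_iff₀ (by linarith)]
        nlinarith
      -- B' > a/2 + (b/2) B at a touching point
      have hex : 1 ≤ Real.exp (b * x / 2) := Real.one_le_exp (by have := hx.1; positivity)
      have hBx : B x = A x * Real.exp (b * x / 2) := rfl
      rw [hfx] at hf'
      refine lt_of_le_of_lt hf' ?_
      rw [hBx]
      nlinarith [hA0 x hx.1, Real.exp_pos (b * x / 2)]
  -- conclude
  have h1 : Real.sqrt (y s) ≤ f s := Real.sqrt_le_sqrt (by linarith [hyY s hs])
  have h2 : Real.sqrt (y₀ + ε) ≤ Real.sqrt y₀ + δ := by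
    have h3 : y₀ + ε ≤ (Real.sqrt y₀ + δ) ^ 2 := by
      nlinarith [Real.sq_sqrt hy₀, Real.sqrt_nonneg y₀, hδ.le]
    calc Real.sqrt (y₀ + ε) ≤ Real.sqrt ((Real.sqrt y₀ + δ) ^ 2) := Real.sqrt_le_sqrt h3
      _ = Real.sqrt y₀ + δ := Real.sqrt_sq (by positivity)
  have h4 : f s ≤ B s := key hs
  have h5 : B s ≤ (Real.sqrt y₀ + a * s / 2) * e + δ' := by
    have hδe : δ * e = δ' / 2 := by
      rw [hδdef]; field_simp
    have hηe : η * s * e ≤ δ' / 2 := by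
      have : η * s * e = δ' / 2 * (s / (s + 1)) := by
        rw [hηdef]; field_simp
      rw [this]
      have hs1 : s / (s + 1) ≤ 1 := by
        rw [div_le_one (by linarith)]; linarith
      nlinarith
    calc B s = (Real.sqrt (y₀ + ε) + (a / 2 + η) * s) * e := rfl
      _ ≤ (Real.sqrt y₀ + δ + (a / 2 + η) * s) * e := by gcongr
      _ = (Real.sqrt y₀ + a * s / 2) * e + (δ * e + η * s * e) := by ring
      _ ≤ (Real.sqrt y₀ + a * s / 2) * e + δ' := by linarith
  linarith

variable {τ ε₀ : ℝ} {α : Fin m → Fin m → Fin m → ℤ × ℤ × ℤ → ℝ} {κ₁ κ₂ : ℝ}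
  {S₀ F₀ B₀ : Fin m → ℤ → ℝ} {S F : Fin m → ℤ → ℝ → ℝ}

/-! ### The one-directional tail step with backscatter -/

/-- **ONE-DIRECTIONAL TAIL STEP on `𝕊` (square-root form).** Along a pseudo-flow on `[0, τ]` on a
nearest-neighbour slot-closed shift set without the class `(1,1,1)` (`τ > 0`, `ε₀ > 0`, cancelling
table on `𝕊`), let the partial sums of the start energies over the shells `k ≥ K` be `≤ E₀` (`E₀ ≥ 0`)
and let `P ≥ 0` bound the amplitudes of the shell `K-1` on `[0, τ]`. Then for every `s ∈ [0, τ]`,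
`√(∑_i F_{i,K}(s)) ≤ (√E₀ + (√2/2) Λ C P² s) · exp(Λ C P s)` with `Λ = (1+ε₀)^{5(K-1)/2}`,
`C = ∑_{botShifts 𝕊}|α|`. [cite: Tao2016AveragedNS, §4 Lemma 4.1 (4.5), (4.9)–(4.10) with (4.3)] -/
theorem pseudoFlowOnShift_sqrt_shell_energy_le_tail (h𝕊 : IsNearestNeighbourSet 𝕊)
    (h𝕊c : IsSlotClosed 𝕊) (h111 : ((1 : ℤ), (1 : ℤ), (1 : ℤ)) ∉ 𝕊)
    (h : PseudoFlowOnShift 𝕊 τ ε₀ α κ₁ κ₂ S₀ F₀ B₀ S F)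
    (hτ : 0 < τ) (hε : 0 < ε₀) (hα : IsCancellingCoeffOn 𝕊 α) (K : ℤ) {E₀ : ℝ} (hE₀0 : 0 ≤ E₀)
    (hE₀ : ∀ L : ℕ, ∑ k ∈ Finset.range L, ∑ i, F₀ i (K + k) ≤ E₀)
    {P : ℝ} (hP0 : 0 ≤ P) (hSP : ∀ u ∈ Icc 0 τ, ∀ i, |S i (K - 1) u| ≤ P) {s : ℝ} (hs : s ∈ Icc 0 τ) :
    Real.sqrt (∑ i, F i K s) ≤
      (Real.sqrt E₀ + Real.sqrt 2 / 2 * (1 + ε₀) ^ ((5 : ℝ) * (K - 1 : ℤ) / 2) *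
          coeffAbsOn (botShifts 𝕊) α * P ^ 2 * s) *
        Real.exp ((1 + ε₀) ^ ((5 : ℝ) * (K - 1 : ℤ) / 2) * coeffAbsOn (botShifts 𝕊) α * P * s) := by
  have hq : 0 < 1 + ε₀ := by linarith
  set Λ : ℝ := (1 + ε₀) ^ ((5 : ℝ) * (K - 1 : ℤ) / 2) with hΛ
  have hΛ0 : 0 ≤ Λ := (Real.rpow_pos_of_pos hq _).le
  set C : ℝ := coeffAbsOn (botShifts 𝕊) α with hC
  have hC0 : 0 ≤ C := coeffAbsOn_nonneg _ _
  have hS : ∀ i n, ContinuousOn (S i n) (Icc 0 τ) := fun i n => (h.contDiffOn_S i n).continuousOn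
  have hFc : ∀ i n, ContinuousOn (F i n) (Icc 0 τ) := fun i n => (h.contDiffOn_F i n).continuousOn
  -- the energy of shell K and the two driving constants
  set y : ℝ → ℝ := fun u => ∑ i, F i K u with hy
  set a : ℝ := Real.sqrt 2 * Λ * C * P ^ 2 with ha
  set b : ℝ := 2 * Λ * C * P with hb
  have ha0 : 0 ≤ a := by positivity
  have hb0 : 0 ≤ b := by positivity
  have hy_cont : ContinuousOn y (Icc 0 τ) := continuousOn_finsetSum _ fun i _ => hFc i K
  have hy0 : ∀ u ∈ Icc 0 τ, 0 ≤ y u := fun u hu => Finset.sum_nonneg fun i _ => h.nonneg_F i K u hu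
  -- the integral inequality y ≤ E₀ + ∫ (a √y + b y)
  have hle : ∀ x ∈ Icc 0 τ, y x ≤ E₀ + ∫ u in (0 : ℝ)..x, (a * Real.sqrt (y u) + b * y u) := by
    intro x hx
    have hsub : uIcc 0 x ⊆ Icc 0 τ := by
      rw [uIcc_of_le hx.1]
      exact Icc_subset_Icc_right hx.2
    have h1 : y x ≤ E₀ + ∫ u in (0 : ℝ)..x, botSumOn 𝕊 ε₀ α S (K - 1) u := by
      have := pseudoFlowOnShift_shell_energy_le_tail h𝕊 h𝕊c h hτ hε hα K hE₀ (le_refl K) hx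
      simpa only [hy] using this
    have hbint : IntervalIntegrable (fun u => botSumOn 𝕊 ε₀ α S (K - 1) u) volume 0 x :=
      ((continuousOn_botSumOn 𝕊 ε₀ α hS (K - 1)).mono hsub).intervalIntegrable
    have hgyint : IntervalIntegrable (fun u => a * Real.sqrt (y u) + b * y u) volume 0 x :=
      (((continuousOn_const.mul hy_cont.sqrt).add (continuousOn_const.mul hy_cont)).mono
        hsub).intervalIntegrable
    have h2 : ∫ u in (0 : ℝ)..x, botSumOn 𝕊 ε₀ α S (K - 1) u ≤
        ∫ u in (0 : ℝ)..x, (a * Real.sqrt (y u) + b * y u) := by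
      refine intervalIntegral.integral_mono_on hx.1 hbint hgyint fun u hu => ?_
      have huτ : u ∈ Icc 0 τ := ⟨hu.1, hu.2.trans hx.2⟩
      have hK : K - 1 + 1 = K := sub_add_cancel K 1
      have hb' := abs_botSumOn_le_tail h𝕊 h111 ε₀ hq α S F (K - 1) u hP0 (hSP u huτ)
        (fun i => by rw [hK]; exact h.nonneg_F i K u huτ)
        (fun i => by rw [hK]; exact h.defect_lower i K u huτ)
      rw [hK] at hb'
      have hsq : Real.sqrt (2 * y u) = Real.sqrt 2 * Real.sqrt (y u) :=
        Real.sqrt_mul (by norm_num) _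
      calc botSumOn 𝕊 ε₀ α S (K - 1) u ≤ |botSumOn 𝕊 ε₀ α S (K - 1) u| := le_abs_self _
        _ ≤ (1 + ε₀) ^ ((5 : ℝ) * (K - 1 : ℤ) / 2) * C *
              (P ^ 2 * Real.sqrt (2 * y u) + 2 * P * y u) := by simpa only [hy, hC] using hb'
        _ = a * Real.sqrt (y u) + b * y u := by rw [hsq, ha, hb, hΛ]; ring
    linarith
  have := sqrt_le_of_integral_le_sqrt_add_linear hy_cont hy0 hE₀0 ha0 hb0 hle s hs
  calc Real.sqrt (∑ i, F i K s) = Real.sqrt (y s) := rfl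
    _ ≤ (Real.sqrt E₀ + a * s / 2) * Real.exp (b * s / 2) := this
    _ = (Real.sqrt E₀ + Real.sqrt 2 / 2 * Λ * C * P ^ 2 * s) * Real.exp (Λ * C * P * s) := by
        simp only [ha, hb]; ring_nf

/-- **ONE-DIRECTIONAL TAIL STEP on `𝕊` (amplitude form).** Under the hypotheses of
`pseudoFlowOnShift_sqrt_shell_energy_le_tail`, every amplitude of shell `K` obeys
`|S_{i,K}(s)| ≤ √2 (√E₀ + (√2/2) Λ C P² s) · exp(Λ C P s)` on `[0, τ]`.
[cite: Tao2016AveragedNS, §4 Lemma 4.1 (4.5), (4.9)–(4.10) with (4.3)] -/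
theorem pseudoFlowOnShift_abs_le_tail_step (h𝕊 : IsNearestNeighbourSet 𝕊)
    (h𝕊c : IsSlotClosed 𝕊) (h111 : ((1 : ℤ), (1 : ℤ), (1 : ℤ)) ∉ 𝕊)
    (h : PseudoFlowOnShift 𝕊 τ ε₀ α κ₁ κ₂ S₀ F₀ B₀ S F)
    (hτ : 0 < τ) (hε : 0 < ε₀) (hα : IsCancellingCoeffOn 𝕊 α) (K : ℤ) {E₀ : ℝ} (hE₀0 : 0 ≤ E₀)
    (hE₀ : ∀ L : ℕ, ∑ k ∈ Finset.range L, ∑ i, F₀ i (K + k) ≤ E₀)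
    {P : ℝ} (hP0 : 0 ≤ P) (hSP : ∀ u ∈ Icc 0 τ, ∀ i, |S i (K - 1) u| ≤ P) (i : Fin m) {s : ℝ}
    (hs : s ∈ Icc 0 τ) :
    |S i K s| ≤ Real.sqrt 2 * ((Real.sqrt E₀ + Real.sqrt 2 / 2 * (1 + ε₀) ^ ((5 : ℝ) * (K - 1 : ℤ) / 2) *
          coeffAbsOn (botShifts 𝕊) α * P ^ 2 * s) *
        Real.exp ((1 + ε₀) ^ ((5 : ℝ) * (K - 1 : ℤ) / 2) * coeffAbsOn (botShifts 𝕊) α * P * s)) := by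
  have h1 : F i K s ≤ ∑ j, F j K s :=
    Finset.single_le_sum (f := fun j => F j K s) (fun j _ => h.nonneg_F j K s hs) (Finset.mem_univ i)
  have h2 : |S i K s| ≤ Real.sqrt (2 * ∑ j, F j K s) :=
    Real.abs_le_sqrt (by linarith [h.defect_lower i K s hs])
  rw [Real.sqrt_mul (by norm_num)] at h2
  exact h2.trans (mul_le_mul_of_nonneg_left
    (pseudoFlowOnShift_sqrt_shell_energy_le_tail h𝕊 h𝕊c h111 h hτ hε hα K hE₀0 hE₀ hP0 hSP hs)
    (Real.sqrt_nonneg 2))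

/-! ### The tail induction -/

/-- **TAIL INDUCTION on `𝕊`.** Along a pseudo-flow on `[0, τ]` on a nearest-neighbour slot-closed shift
set without `(1,1,1)` (`τ > 0`, `ε₀ > 0`, cancelling table on `𝕊`), let `k₂` be a shell, `E K ≥ 0` bounds
for all partial sums of the start energies above every `K ≥ k₂`, and `P : ℤ → ℝ` nonnegative
candidate amplitude bounds satisfying the RECURSION CONDITION
`√2 · (√(E K) + (√2/2) Λ_{K-1} C τ P(K-1)²) · exp(Λ_{K-1} C P(K-1) τ) ≤ P K` for `K ≥ k₂`
(`Λ_{K-1} = (1+ε₀)^{5(K-1)/2}`, `C = ∑_{botShifts 𝕊}|α|`). If the base shell obeys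
`|S_{i,k₂-1}(u)| ≤ P(k₂-1)` on `[0, τ]`, then EVERY shell `K ≥ k₂ - 1` obeys `|S_{i,K}(u)| ≤ P K` on
`[0, τ]`. [cite: Tao2016AveragedNS, §4 Lemma 4.1 (4.5), (4.9)–(4.10) with (4.3)] -/
theorem pseudoFlowOnShift_tail_induction (h𝕊 : IsNearestNeighbourSet 𝕊)
    (h𝕊c : IsSlotClosed 𝕊) (h111 : ((1 : ℤ), (1 : ℤ), (1 : ℤ)) ∉ 𝕊)
    (h : PseudoFlowOnShift 𝕊 τ ε₀ α κ₁ κ₂ S₀ F₀ B₀ S F)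
    (hτ : 0 < τ) (hε : 0 < ε₀) (hα : IsCancellingCoeffOn 𝕊 α) (k₂ : ℤ) {E P : ℤ → ℝ}
    (hE0 : ∀ K : ℤ, k₂ ≤ K → 0 ≤ E K) (hP0 : ∀ K : ℤ, k₂ - 1 ≤ K → 0 ≤ P K)
    (hE : ∀ K : ℤ, k₂ ≤ K → ∀ L : ℕ, ∑ k ∈ Finset.range L, ∑ i, F₀ i (K + k) ≤ E K)
    (hrec : ∀ K : ℤ, k₂ ≤ K →
      Real.sqrt 2 * ((Real.sqrt (E K) + Real.sqrt 2 / 2 * (1 + ε₀) ^ ((5 : ℝ) * (K - 1 : ℤ) / 2) *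
          coeffAbsOn (botShifts 𝕊) α * P (K - 1) ^ 2 * τ) *
        Real.exp ((1 + ε₀) ^ ((5 : ℝ) * (K - 1 : ℤ) / 2) * coeffAbsOn (botShifts 𝕊) α *
          P (K - 1) * τ)) ≤ P K)
    (hbase : ∀ u ∈ Icc 0 τ, ∀ i, |S i (k₂ - 1) u| ≤ P (k₂ - 1)) :
    ∀ K : ℤ, k₂ - 1 ≤ K → ∀ u ∈ Icc 0 τ, ∀ i, |S i K u| ≤ P K := by
  have hq : 0 < 1 + ε₀ := by linarith
  have hC0 : 0 ≤ coeffAbsOn (botShifts 𝕊) α := coeffAbsOn_nonneg _ _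
  -- induction on the number of shells above the base
  have key : ∀ n : ℕ, ∀ u ∈ Icc 0 τ, ∀ i, |S i (k₂ - 1 + n) u| ≤ P (k₂ - 1 + n) := by
    intro n
    induction n with
    | zero => simpa using hbase
    | succ n ih =>
      intro u hu i
      have hK : k₂ ≤ k₂ - 1 + (n + 1 : ℕ) := by push_cast; linarith
      set K : ℤ := k₂ - 1 + (n + 1 : ℕ) with hKdef
      have hKm : K - 1 = k₂ - 1 + n := by rw [hKdef]; push_cast; ring
      have hPK1 : 0 ≤ P (K - 1) := hP0 (K - 1) (by rw [hKm]; linarith)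
      have hSP : ∀ v ∈ Icc 0 τ, ∀ j, |S j (K - 1) v| ≤ P (K - 1) := by
        intro v hv j
        rw [hKm]
        exact ih v hv j
      have hstep := pseudoFlowOnShift_abs_le_tail_step h𝕊 h𝕊c h111 h hτ hε hα K (hE0 K hK) (hE K hK)
        hPK1 hSP i hu
      set Λ : ℝ := (1 + ε₀) ^ ((5 : ℝ) * (K - 1 : ℤ) / 2) with hΛ
      have hΛ0 : 0 ≤ Λ := (Real.rpow_pos_of_pos hq _).le
      -- monotonicity in the time variable `u ≤ τ`
      have hmono : Real.sqrt 2 * ((Real.sqrt (E K) + Real.sqrt 2 / 2 * Λ *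
            coeffAbsOn (botShifts 𝕊) α * P (K - 1) ^ 2 * u) *
          Real.exp (Λ * coeffAbsOn (botShifts 𝕊) α * P (K - 1) * u)) ≤
          Real.sqrt 2 * ((Real.sqrt (E K) + Real.sqrt 2 / 2 * Λ *
            coeffAbsOn (botShifts 𝕊) α * P (K - 1) ^ 2 * τ) *
          Real.exp (Λ * coeffAbsOn (botShifts 𝕊) α * P (K - 1) * τ)) := by
        have h1 : Real.sqrt 2 / 2 * Λ * coeffAbsOn (botShifts 𝕊) α * P (K - 1) ^ 2 * u ≤
            Real.sqrt 2 / 2 * Λ * coeffAbsOn (botShifts 𝕊) α * P (K - 1) ^ 2 * τ :=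
          mul_le_mul_of_nonneg_left hu.2 (by positivity)
        have h2 : Real.exp (Λ * coeffAbsOn (botShifts 𝕊) α * P (K - 1) * u) ≤
            Real.exp (Λ * coeffAbsOn (botShifts 𝕊) α * P (K - 1) * τ) :=
          Real.exp_le_exp.mpr (mul_le_mul_of_nonneg_left hu.2 (by positivity))
        have h3 : 0 ≤ Real.sqrt (E K) + Real.sqrt 2 / 2 * Λ *
            coeffAbsOn (botShifts 𝕊) α * P (K - 1) ^ 2 * u := by
          have := hu.1; positivity
        gcongr
      exact (hstep.trans hmono).trans (hrec K hK)
  intro K hK u hu i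
  obtain ⟨n, hn⟩ := Int.eq_ofNat_of_zero_le (show 0 ≤ K - (k₂ - 1) by linarith)
  have hK' : K = k₂ - 1 + (n : ℤ) := by linarith
  rw [hK']
  exact key n u hu i

end GappedFrontRobustOn

end Summit.NavierStokesRegularity.NavierStokesRegularity.Theorems

end
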